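/-
Copyright: cell pub-balaban-gaps (YM BLITZ Y1, track G1), seat g1-p2 GEN 4 (unit `pub-balaban-gaps-g1-p2`).  Row (D4) NODE O,
OBJECT ∕ MECHANISM level: [B9] THEOREM 3.10 AT ONE SCALE in the BLOCK currency, END TO END (rungs §1–6 of `BLOCKNORM-ADAPTER.md`
composed) — the V47 repair: the Neumann margin is `q = O(λ_R)` at FIXED cube-rate letters, NO fibre, NO site row sum.
HONEST FRAMING: model ∕ mechanism over landed hypothesis SHAPES; nothing of Bałaban's constructed or asserted; (D4) NOT
discharged (instance 0∕1); NOT BetaPertH, NOT continuum, NOT Clay.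
-/
import Summits.QuantumFields.BalabanUV.Gaps.D4WalkBlockGlue
import Summits.QuantumFields.BalabanUV.Gaps.D4WalkBlockLocal

/-!
# `Gaps.D4WalkBlockOneScale` — Thm 3.10 at one scale in block currency: margin `O(λ_R)` at fixed cube geometry (cell pub-balaban-gaps, seat g1-p2 gen 4)

HONEST DEPENDENCY (cell pub-balaban, verbatim): continuum YM on T⁴ ⇐ BetaPertH ∧ nine spine estimates (0/9 proved);
BetaPertH ⇐ (D1) ∧ (D4) ∧ CAP+tail.

[B9] p. 409 (3.87)–(3.90), Cor 3.8 p. 410, Thm 3.10 (3.107)–(3.108) p. 416: with `‖h_□G′_□h_□‖`, `‖K(h_□)G′_□h_□‖ = O(M⁻¹)`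
as OPERATOR norms between M-cubes, `G′ = S(1 − R)⁻¹ = Σ_n SRⁿ` converges *"for M sufficiently large"* and is a sum over walks
with the bounds (3.108), *"The constant O(1) depends on d and L only"*.  `blockWalkExpansion_oneScale`: if the seed family `S`
and the step family `R` are DOMAIN-LOCALISED one-step operator families on the CUBE torus with OPERATOR-norm letters
(`D4WalkBlockLocal.IsDomainLocalB` with letters `(R, λ_S ∕ λ_R, r, m_J, n_D)`: blocks vanishing off the domain's cube pairs and
bounded by `λ` in `ℓ^∞ → ℓ^∞` block norm on the `R`-ball, domains of diameter `≤ r` CUBE steps meeting the σ-region when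
σ-carrying, `≤ n_D` domains per anchor cube), the cube row sum (2.61) holds at rate `μ` with constant `c_μ` (`c₀(1,μ)^ν` on every
cube torus), the rates satisfy `0 ≤ μ`, `3μ ≤ ε₀`, `2μ ≤ κ₀`, `κ₀ + μ ≤ ρ₀ − ε₀`, and the Neumann MARGIN
`q = c_μ(c_μ·1·(1·K̄_R)c_μ)c_μ < 1` holds, `K̄_R = λ_Re^{κ₁m_J}e^{2ρ₀r}e^{μr}n_Dc_μ`, then `(σ,u) ↦ S(σ,u)·(1 − R(σ,u))⁻¹` is a
`BlockWalkExpansion` on the `R`-ball at walk rate `ρ₀ − 3μ`, window `ε₀ − 3μ`, torus rate `κ₀ − 2μ`, constant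
`c_μ·K̄_S·(1·(1 − q)⁻¹)·c_μ` — EVERY LETTER INDEPENDENT OF THE TORUS —, terms ∃-packaged, walk distances dominating `d₁`; by
`BlockWalkExpansion.toJoint` it is a `JointWalkExpansion` with the cube maps as locators, so every NODE-A consumer applies.
THE REGIME (the point of the block currency, RESIDUE (D4) v1.11 row V47): `r`, `ρ₀`, `μ` are O(1) in CUBE units (a domain is a
few cubes), `n_D` = O(1), `c_μ` = O(1) ⟹ `K̄_R = O(λ_R)` and `q = O(λ_R)`: `q < 1` is a smallness condition on the OPERATOR letter
`λ_R` of the step family ALONE at fixed geometry — print's *"K(h_□) = O(M⁻¹), M sufficiently large"* read as `λ_R` small —, not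
the small-coupling ∕ small-fibre condition of the flat currency (`D4WalkOneScale`: `(mc_μ)²` with `m` = sites × components per
cube and `c_μ` a SITE row sum).  Composition by name: `D4WalkBlockLocal.blockWalkExpansion_domainLocal` (×2) →
`D4WalkBlockGlue.blockWalkExpansion_glue`.
WHAT IT IS NOT: Bałaban's `Δ′`, `G′_□`, `h_□`, `K(h_□)` are NOT constructed and (3.89) is NOT proved — the two `IsDomainLocalB`
data are the Cor 3.6 ∕ (3.89)-type HYPOTHESES in block currency; the multi-scale structure (𝒟_k, block averaging, covariant
operators), k-uniformity (G-B9-10 ∕ (v)) and `TermDomination` remain; (D4) instance 0∕1; words UNCHANGED.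
-/

noncomputable section

namespace Summit.QuantumFields.BalabanUV.Gaps.D4WalkBlockOneScale

open Metric Set Finset
open Literature.MathematicalPhysics.QuantumFieldTheory.Balaban1983to89
open Literature.MathematicalPhysics.QuantumFieldTheory.Balaban1983to89.B9SectDWalk (Through MajSumLe DomBy)
open Literature.MathematicalPhysics.QuantumFieldTheory.Balaban1983to89.B9Thm34Ext (toB6)
open Literature.MathematicalPhysics.QuantumFieldTheory.Balaban1983to89.B9Thm37GlueTorus (torusGeom tdist1 tdist1_nonneg)
open Literature.MathematicalPhysics.QuantumFieldTheory.Balaban1983to89.TreeLengthTorus (TPt)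
open Literature.MathematicalPhysics.QuantumFieldTheory.Balaban1983to89.B5TorusCover (UT)
open Literature.MathematicalPhysics.QuantumFieldTheory.Balaban1983to89.B11SectG (RowSum)
open Literature.MathematicalPhysics.QuantumFieldTheory.Balaban1983to89.B13JointWalkExpansion (JointWalkExpansion)
open Literature.MathematicalPhysics.QuantumFieldTheory.Balaban1983to89.B13DomainKernelWalks (DomainTerms)
open Summit.QuantumFields.BalabanUV.Gaps.D4WalkBlock (BlockWalkExpansion)
open Summit.QuantumFields.BalabanUV.Gaps.D4WalkBlockLocal (IsDomainLocalB blockWalkExpansion_domainLocal)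
open Summit.QuantumFields.BalabanUV.Gaps.D4WalkBlockGlue (blockWalkExpansion_glue)

variable {ν : ℕ} {K : Fin ν → ℕ} [∀ i, NeZero (K i)]
variable {d N' : ℕ} {p n : Type} [Fintype p] [Fintype n] [DecidableEq n]
variable {E : Type*} [NormedAddCommGroup E] [NormedSpace ℂ E]
variable {c : B13.Consts} {cub : p → UT K} {cubn : n → UT K} {X : Finset (UT K)}

/-- **THEOREM 3.10 AT ONE SCALE, BLOCK CURRENCY**: domain-localised seed family `S` (`p × n`) and step family `R` (`n × n`) with
OPERATOR-norm letters `λ_S`, `λ_R` on the cube torus, one cube row-sum rate `μ` (constant `c_μ`), rates `0 ≤ μ`, `3μ ≤ ε₀`,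
`2μ ≤ κ₀`, `κ₀ + μ ≤ ρ₀ − ε₀`, and the margin `q = c_μ(c_μ·1·(1·K̄_R)c_μ)c_μ < 1` (NO fibre letter) ⟹ the glued inverse
`S·(1 − R)⁻¹` is a block walk expansion at `(ρ₀ − 3μ, ε₀ − 3μ, κ₀ − 2μ)` with constant `c_μ·K̄_S·(1·(1 − q)⁻¹)·c_μ`, all letters
torus-free. [cite: Balaban1985BackgroundPropagators, (3.87)–(3.90) p.409, Cor 3.8 p.410, Thm 3.10 (3.107)–(3.108) p.416, p.422; Balaban1984PropagatorsII, (2.61) p.234; Balaban1988RG2Cluster, (1.11) p.5, p.13, p.15] -/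
theorem blockWalkExpansion_oneScale {LS : DomainTerms d N' ν K p n E} {LR : DomainTerms d N' ν K n n E}
    {R lamS lamR r : ℝ} {mJ nD : ℕ} {ρ₀ ε₀ κ₀ μ cμ : ℝ}
    (hS : IsDomainLocalB LS c cub cubn X R lamS r mJ nD) (hR : IsDomainLocalB LR c cubn cubn X R lamR r mJ nD)
    (hκ₁ : 0 ≤ c.κ₁) (hlamS : 0 ≤ lamS) (hlamR : 0 ≤ lamR)
    (hμ : 0 ≤ μ) (hμε : 3 * μ ≤ ε₀) (hμκ : 2 * μ ≤ κ₀) (hwin : κ₀ + μ ≤ ρ₀ - ε₀) (hcμ : 0 ≤ cμ)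
    (hrow : RowSum (toB6 (torusGeom K 0 0 0) 0 True) μ cμ)
    (hq : cμ * (cμ * 1 *
      (1 * ((lamR * Real.exp (c.κ₁ * mJ) * Real.exp (2 * ρ₀ * r)) * Real.exp (μ * r) * (nD * cμ))) * cμ) * cμ < 1) :
    ∃ (W : Type) (T : W → (TPt d N' → ℂ) → E → Matrix p n ℂ) (SX : Set W) (A : W → ℝ) (D : W → UT K → UT K → ℝ)
      (ρ' : ℝ), BlockWalkExpansion c cub cubn
        (fun σ₀ u => LS.kernel σ₀ u * ((1 : Matrix n n ℂ) + (-1 : ℂ) • LR.kernel σ₀ u)⁻¹) X R (ε₀ - 3 * μ) (κ₀ - 2 * μ)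
        (cμ * ((lamS * Real.exp (c.κ₁ * mJ) * Real.exp (2 * ρ₀ * r)) * Real.exp (μ * r) * (nD * cμ)) *
          (1 * (1 - cμ * (cμ * 1 *
            (1 * ((lamR * Real.exp (c.κ₁ * mJ) * Real.exp (2 * ρ₀ * r)) * Real.exp (μ * r) * (nD * cμ))) * cμ) * cμ)⁻¹) * cμ)
        T SX A D ρ' ∧
      ∀ ω, DomBy (toB6 (torusGeom K 0 0 0) 0 True) (D ω) := by
  have hκ₀ : 0 ≤ κ₀ := by linarith
  have hρ₀ : 0 ≤ ρ₀ := by linarith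
  -- the two domain-local BLOCK expansions at (ρ₀, ε₀, κ₀)
  have hSw := blockWalkExpansion_domainLocal hS hκ₁ hlamS hρ₀ hκ₀ hμ hwin hrow
  have hRw := blockWalkExpansion_domainLocal hR hκ₁ hlamR hρ₀ hκ₀ hμ hwin hrow
  -- glue: Neumann window (ρ₀ − 2μ, ε₀ − 2μ), ρ_s = ρ₀ − μ, κ_s = κ₀ − μ, κ = κ₀ − 2μ; product window (ρ₀ − 3μ, ε₀ − 3μ, κ₀ − 2μ)
  exact blockWalkExpansion_glue (ρ := ρ₀ - 2 * μ) (ε := ε₀ - 2 * μ) (ρs := ρ₀ - μ) (κs := κ₀ - μ) (κ := κ₀ - 2 * μ)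
    (ρ' := ρ₀ - 3 * μ) (ε' := ε₀ - 3 * μ) (κ' := κ₀ - 2 * μ)
    hSw hRw (fun b => LS.domBy_dist X b) (fun b => LR.domBy_dist X b) hrow hrow hμ hμ hcμ hcμ
    -- step 1 (Neumann): hε hερ hρs hρsR hwR hKR hκs hκsR hκsC hκ hκC hκκs hq
    (by linarith) (by linarith) (by linarith) (by linarith) (by linarith) (by positivity) (by linarith) (by linarith)
    (by linarith) (by linarith) (by linarith) (by linarith) hq
    -- step 2 (product): hρ' hρ'ρ hρ'S hε' hwS hw1 hKS hκ' hκ'κ hκ'S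
    (by linarith) (by linarith) (by linarith) (by linarith) (by linarith) (by linarith) (by positivity) (by linarith) le_rfl
    (by linarith)

/-- **… read off entrywise**: the same glued family is a `JointWalkExpansion` with the cube maps as locators (so `TermWalkData` ∕
`differences216_of_termWalkData` and the (v)⁺ shape consume it verbatim), with the block-currency constant — margin `O(λ_R)` at
fixed cube geometry. [cite: Balaban1985BackgroundPropagators, Thm 3.10 (3.107)–(3.108) p.416, p.422] -/
theorem jointWalkExpansion_oneScale_block {LS : DomainTerms d N' ν K p n E} {LR : DomainTerms d N' ν K n n E}
    {R lamS lamR r : ℝ} {mJ nD : ℕ} {ρ₀ ε₀ κ₀ μ cμ : ℝ}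
    (hS : IsDomainLocalB LS c cub cubn X R lamS r mJ nD) (hR : IsDomainLocalB LR c cubn cubn X R lamR r mJ nD)
    (hκ₁ : 0 ≤ c.κ₁) (hlamS : 0 ≤ lamS) (hlamR : 0 ≤ lamR)
    (hμ : 0 ≤ μ) (hμε : 3 * μ ≤ ε₀) (hμκ : 2 * μ ≤ κ₀) (hwin : κ₀ + μ ≤ ρ₀ - ε₀) (hcμ : 0 ≤ cμ)
    (hrow : RowSum (toB6 (torusGeom K 0 0 0) 0 True) μ cμ)
    (hq : cμ * (cμ * 1 *
      (1 * ((lamR * Real.exp (c.κ₁ * mJ) * Real.exp (2 * ρ₀ * r)) * Real.exp (μ * r) * (nD * cμ))) * cμ) * cμ < 1) :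
    ∃ (W : Type) (T : W → (TPt d N' → ℂ) → E → Matrix p n ℂ) (SX : Set W) (A : W → ℝ) (D : W → UT K → UT K → ℝ)
      (ρ' : ℝ), JointWalkExpansion c cub cubn
        (fun σ₀ u => LS.kernel σ₀ u * ((1 : Matrix n n ℂ) + (-1 : ℂ) • LR.kernel σ₀ u)⁻¹) X R (ε₀ - 3 * μ) (κ₀ - 2 * μ)
        (cμ * ((lamS * Real.exp (c.κ₁ * mJ) * Real.exp (2 * ρ₀ * r)) * Real.exp (μ * r) * (nD * cμ)) *
          (1 * (1 - cμ * (cμ * 1 *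
            (1 * ((lamR * Real.exp (c.κ₁ * mJ) * Real.exp (2 * ρ₀ * r)) * Real.exp (μ * r) * (nD * cμ))) * cμ) * cμ)⁻¹) * cμ)
        T SX A D ρ' ∧
      ∀ ω, DomBy (toB6 (torusGeom K 0 0 0) 0 True) (D ω) := by
  obtain ⟨W, T, SX, A, D, ρ', h, hdom⟩ := blockWalkExpansion_oneScale hS hR hκ₁ hlamS hlamR hμ hμε hμκ hwin hcμ hrow hq
  exact ⟨W, T, SX, A, D, ρ', h.toJoint, hdom⟩

end Summit.QuantumFields.BalabanUV.Gaps.D4WalkBlockOneScale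

end
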